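import Literature.AlgebraicGeometry.HodgeTheory.LevelOneSubHodgeStructuresWeightOneForm
import Literature.AlgebraicGeometry.HodgeTheory.HodgeRiemannPolarizabilityProofs
import Literature.AlgebraicGeometry.Motives.HodgeStructureSemisimple
import Literature.AlgebraicGeometry.Motives.HodgeStructureStrictProofs
import HarnessLib

/-!
# Crux `ConiveauOneFailure` (stmt-HodgeConjecture-3540), line `birth`, stub S2b₁:
# an injective restriction `H¹(S) ↪ H¹(C)` is split by a surjective Hodge map `H¹(C) ↠ H¹(S)`

Helper file for the statement item stmt-HodgeConjecture-3540 (route `SecondaryPeriods`, crux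
`ConiveauOneFailure`, registered birth skeleton, stub `stub_surjective_hodgeMap_of_injective`).
What is proved, and from which sources:

* `hodgeStructureHom_exists_retraction_of_injective` — **retractions in the semisimple category
  of polarisable Hodge structures** (pure linear algebra on the tree's `Motives.HodgeStructure`):
  an injective morphism `f : H₁ → H₂` of `ℚ`-Hodge structures of the same weight, with `H₂`
  finite-dimensional and polarisable, has a retraction `r : H₂ → H₁`, `r ∘ f = id`, which is
  again a morphism of Hodge structures. Proof: the image `im f` underlies a sub-Hodge structure
  (`Hom.exists_subHodgeStructure_range`), which has a complementary sub-Hodge structure `T'`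
  (semisimplicity, `SubHodgeStructure.exists_isCompl`: Voisin I, Lemma 7.26; Voisin 2025,
  Prop. 2.11); `r` is the projection onto `im f` along `T'` followed by `f⁻¹`
  (`LinearMap.linearProjOfIsCompl`). That `r ⊗ ℂ` respects the Hodge filtrations is the
  strictness argument (Deligne, Hodge II, Thm. 2.3.5 (iii)): split `r_ℂ y` along
  `F^p H₁ ⊕ conj F^{n+1-p} H₁` and the `T'`-component of `y` along the induced opposed
  filtrations of `T'`; the two "`conj`" parts sum to an element of `F^p H₂ ∩ conj F^{n+1-p} H₂ = 0`,
  and applying `r_ℂ` kills the `T'`-part, so the `conj`-part of `r_ℂ y` vanishes.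
* `stub_surjective_hodgeMap_of_injective` — THE STUB: for a smooth projective surface `S`, a
  smooth projective curve `C` and `i : C → S` with `i^* : H¹(S(ℂ); ℂ) → H¹(C(ℂ); ℂ)` injective,
  there are Hodge models `A` of `S`, `B` of `C` (we take REAL models,
  `exists_isReal_hodgeModel_holds`) and a SURJECTIVE `ℂ`-linear `φ : H¹(C(ℂ); ℂ) ↠ H¹(S(ℂ); ℂ)`
  sending rational classes to rational classes and classes of type `(p, q)` read in `B` to classes
  of type `(p, q)` read in `A`. Proof (Voisin I, §7.3.1–7.3.2): `i^*` on RATIONAL cohomology is a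
  morphism of the weight-one Hodge structures of the models (`HodgeModel.hodgeStructureHom`,
  `hodgePQ_independent_of_hodgeModel_holds`), injective because its complexification is `i^*` on
  `H¹(–; ℂ)` under the universal-coefficient isomorphisms `β : H¹(–; ℚ) ⊗ ℂ ≅ H¹(–; ℂ)`
  (`ofRatClassBaseChange_baseChange_map`, `ofRatClassBaseChange_injective`); `H¹(C(ℂ); ℚ)` is
  polarisable (`smoothProjective_hodgeStructure_isPolarizable_holds`) and finite-dimensional, so
  the retraction lemma gives `r` with `r ∘ i^* = id`; `φ := β_S ∘ (r ⊗ ℂ) ∘ β_C⁻¹` is rational on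
  rational classes (`ofRatClassBaseChange_ofRat`), of type `(0,0)` (`Hom.map_piece_le`,
  `HodgeModel.piece_eq_ratPiece`), and `φ ∘ i^* = id` on `H¹(S(ℂ); ℂ)`, whence onto.

## References

* [VoisinHodgeI2002] C. Voisin, Hodge Theory and Complex Algebraic Geometry I, CUP 2002, §7.1.1,
  §7.3.1 (Def. 7.22–7.24, Lemma 7.26), §7.3.2.
* [GrothendieckTopology1969] A. Grothendieck, Hodge's general conjecture is false for trivial
  reasons, Topology 8 (1969), p. 301.
-/

-- every declaration of this problem lives in `Summit.HodgeConjecture.HodgeConjecture.…` (summit =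
-- sub-problem), which `linter.dupNamespace` flags
set_option linter.dupNamespace false

noncomputable section

open scoped TensorProduct
open CategoryTheory
open Literature.AlgebraicGeometry.Motives Literature.AlgebraicGeometry.HodgeTheory
  Literature.AlgebraicTopology.SingularHomology

namespace Summit.HodgeConjecture.HodgeConjecture.Theorems

universe u v

/-! ### Retractions of injective morphisms of polarisable Hodge structures -/

/-- **An injective morphism into a polarisable Hodge structure has a Hodge-theoretic retraction**
(semisimplicity of the category of polarisable rational Hodge structures, Voisin I, Lemma 7.26;
Voisin 2025, Prop. 2.11 and the proof of Cor. 2.12: "`φ` has a left inverse as morphism of Hodge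
structures"). For Hodge structures `H₁` on `V₁` and `H₂` on `V₂` of the same weight `n`, `V₂`
finite-dimensional and `H₂` polarisable, and a morphism `f : H₁ → H₂` injective on the underlying
spaces, there is a morphism `r : H₂ → H₁` with `r ∘ f = id`: the projection onto the sub-Hodge
structure `im f` along a complementary sub-Hodge structure `T'` (`SubHodgeStructure.exists_isCompl`)
followed by `f⁻¹`; compatibility with `F` is the strictness argument (Deligne, Hodge II,
Thm. 2.3.5 (iii)) run with the opposed filtrations of `H₁`, of `T'` and of `H₂`.
[cite: VoisinHodgeI2002, §7.3.1 Lemma 7.26] -/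
theorem hodgeStructureHom_exists_retraction_of_injective
    {V₁ : Type u} {V₂ : Type v} [AddCommGroup V₁] [Module ℚ V₁] [AddCommGroup V₂] [Module ℚ V₂]
    [Module.Finite ℚ V₂] {n : ℤ} {H₁ : HodgeStructure V₁ n} {H₂ : HodgeStructure V₂ n}
    (hH₂ : H₂.IsPolarizable) (f : HodgeStructure.Hom H₁ H₂)
    (hf : Function.Injective f.toLinearMap) :
    ∃ r : HodgeStructure.Hom H₂ H₁, r.toLinearMap ∘ₗ f.toLinearMap = LinearMap.id := by
  -- the image `T = im f` is a sub-Hodge structure, with a complementary sub-Hodge structure `T'`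
  obtain ⟨T, hT⟩ := f.exists_subHodgeStructure_range
  obtain ⟨T', hTT'⟩ := T.exists_isCompl hH₂
  have hc : IsCompl (LinearMap.range f.toLinearMap) T'.toSubmodule := hT ▸ hTT'
  -- the retraction over `ℚ`: the projection onto `im f` along `T'`, followed by `f⁻¹`
  set rq : V₂ →ₗ[ℚ] V₁ := LinearMap.linearProjOfIsCompl T'.toSubmodule f.toLinearMap hf hc with hrq
  have hrf : rq ∘ₗ f.toLinearMap = LinearMap.id :=
    LinearMap.ext fun x ↦ LinearMap.linearProjOfIsCompl_apply_left _ _ hf hc x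
  have hrT' : rq ∘ₗ T'.toSubmodule.subtype = 0 :=
    LinearMap.ext fun x ↦ LinearMap.linearProjOfIsCompl_apply_right _ _ hf hc x
  have hfr : ∀ x, f.toLinearMap (rq x) =
      (LinearMap.range f.toLinearMap).projection T'.toSubmodule hc x := fun x ↦ by
    rw [hrq, LinearMap.linearProjOfIsCompl, LinearMap.comp_apply, LinearEquiv.coe_coe,
      LinearEquiv.ofInjective_symm_apply, Submodule.coe_projectionOnto_apply]
  -- the decomposition `y = f_ℂ (r_ℂ y) + ι_{T'} (π'_ℂ y)` of `V₂ ⊗ ℂ`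
  set ι' : ℂ ⊗[ℚ] T'.toSubmodule →ₗ[ℂ] ℂ ⊗[ℚ] V₂ := T'.toSubmodule.subtype.baseChange ℂ with hι'
  set π' : V₂ →ₗ[ℚ] T'.toSubmodule :=
    T'.toSubmodule.projectionOnto (LinearMap.range f.toLinearMap) hc.symm with hπ'
  have hdec : ∀ y : ℂ ⊗[ℚ] V₂,
      y = f.toLinearMap.baseChange ℂ (rq.baseChange ℂ y) + ι' (π'.baseChange ℂ y) := by
    intro y
    have hid : f.toLinearMap ∘ₗ rq + T'.toSubmodule.subtype ∘ₗ π' = LinearMap.id := by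
      refine LinearMap.ext fun x ↦ ?_
      rw [LinearMap.add_apply, LinearMap.comp_apply, LinearMap.comp_apply, hfr x,
        LinearMap.id_apply]
      exact Submodule.projection_add_projection_eq_self hc x
    have h := congrArg (fun g : V₂ →ₗ[ℚ] V₂ ↦ g.baseChange ℂ y) hid
    simp only [LinearMap.baseChange_add, LinearMap.baseChange_comp, LinearMap.baseChange_id,
      LinearMap.add_apply, LinearMap.comp_apply, LinearMap.id_apply] at h
    exact h.symm
  -- `r_ℂ ∘ f_ℂ = id`, `r_ℂ ∘ ι_{T'} = 0`
  have hrfC : ∀ x : ℂ ⊗[ℚ] V₁, rq.baseChange ℂ (f.toLinearMap.baseChange ℂ x) = x := fun x ↦ by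
    rw [← LinearMap.comp_apply, ← LinearMap.baseChange_comp, hrf, LinearMap.baseChange_id,
      LinearMap.id_apply]
  have hrιC : ∀ b : ℂ ⊗[ℚ] T'.toSubmodule, rq.baseChange ℂ (ι' b) = 0 := fun b ↦ by
    rw [hι', ← LinearMap.comp_apply, ← LinearMap.baseChange_comp, hrT', LinearMap.baseChange_zero,
      LinearMap.zero_apply]
  refine ⟨⟨rq, fun p ↦ ?_⟩, hrf⟩
  rintro _ ⟨y, hy, rfl⟩
  rw [SetLike.mem_coe] at hy
  have hpq : p + (n + 1 - p) = n + 1 := by ring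
  -- split `x = r_ℂ y` along `F^p H₁ ⊕ conj F^{n+1-p} H₁`
  set x := rq.baseChange ℂ y with hx
  have hxs : x ∈ H₁.F p ⊔ HodgeStructure.complexConj (H₁.F (n + 1 - p)) := by
    rw [(H₁.isCompl_F_complexConj p (n + 1 - p) hpq).sup_eq_top]
    exact Submodule.mem_top
  obtain ⟨a₁, ha₁, a₂, ha₂, hxa⟩ := Submodule.mem_sup.1 hxs
  -- split the `T'`-component `b` of `y` along the induced opposed filtrations of `T'`
  set b := π'.baseChange ℂ y with hb
  have hbs : b ∈ (H₂.F p).comap ι' ⊔ (HodgeStructure.complexConj (H₂.F (n + 1 - p))).comap ι' := by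
    rw [(T'.isCompl p (n + 1 - p) hpq).sup_eq_top]
    exact Submodule.mem_top
  obtain ⟨b₁, hb₁, b₂, hb₂, hbb⟩ := Submodule.mem_sup.1 hbs
  rw [Submodule.mem_comap] at hb₁ hb₂
  -- the `conj` parts sum to an element of `F^p H₂ ∩ conj F^{n+1-p} H₂ = 0`
  have hfa₁ : f.toLinearMap.baseChange ℂ a₁ ∈ H₂.F p := f.map_F_le p ⟨a₁, ha₁, rfl⟩
  have hfa₂ : f.toLinearMap.baseChange ℂ a₂ ∈ HodgeStructure.complexConj (H₂.F (n + 1 - p)) :=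
    f.map_complexConj_F_le (n + 1 - p) ⟨a₂, ha₂, rfl⟩
  have hysum : y = (f.toLinearMap.baseChange ℂ a₁ + ι' b₁) + (f.toLinearMap.baseChange ℂ a₂ + ι' b₂) := by
    conv_lhs => rw [hdec y, ← hx, ← hb, ← hxa, ← hbb]
    rw [map_add, map_add]
    abel
  have hz : f.toLinearMap.baseChange ℂ a₂ + ι' b₂ = 0 := by
    rw [← Submodule.mem_bot ℂ, ← (H₂.isCompl_F_complexConj p (n + 1 - p) hpq).inf_eq_bot]
    refine ⟨?_, Submodule.add_mem _ hfa₂ hb₂⟩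
    have h := (H₂.F p).sub_mem hy (Submodule.add_mem _ hfa₁ hb₁)
    rwa [hysum, add_sub_cancel_left] at h
  -- applying `r_ℂ` kills the `T'`-part: `a₂ = 0`
  have ha₂0 : a₂ = 0 := by
    have h := congrArg (rq.baseChange ℂ) hz
    rwa [map_add, hrfC, hrιC, add_zero, map_zero] at h
  rw [← hxa, ha₂0, add_zero]
  exact ha₁

/-! ### The stub -/

/-- **STUB S2b₁ — an injective restriction `H¹(S) ↪ H¹(C)` is split by a surjective HODGE map
`H¹(C) ↠ H¹(S)`.** For a smooth projective surface `S`, a smooth projective curve `C` and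
`i : C → S` with `i^*` injective on `H¹(S(ℂ); ℂ)`, there are Hodge models `A` of `S`, `B` of `C`
(real ones) and a SURJECTIVE `ℂ`-linear `φ : H¹(C(ℂ); ℂ) ↠ H¹(S(ℂ); ℂ)` sending rational classes
to rational classes and classes of type `(p, q)` read in `B` to classes of type `(p, q)` read in
`A`. Proof: `i^* : H¹(S(ℂ); ℚ) → H¹(C(ℂ); ℚ)` is an injective morphism of the polarisable
weight-one Hodge structures of the real models (`HodgeModel.hodgeStructureHom`,
`smoothProjective_hodgeStructure_isPolarizable_holds`); by semisimplicity it has a retraction `r`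
which is a morphism of Hodge structures (`hodgeStructureHom_exists_retraction_of_injective`);
`φ = β_S ∘ (r ⊗ ℂ) ∘ β_C⁻¹` with `β : H¹(–; ℚ) ⊗ ℂ ≅ H¹(–; ℂ)` (`ofRatClassBaseChangeEquiv`), and
`φ ∘ i^* = id`. [cite: VoisinHodgeI2002, §7.3.1 Def. 7.22–7.24, Lemma 7.26 and §7.3.2]
[cite: GrothendieckTopology1969, p. 301] -/
theorem stub_surjective_hodgeMap_of_injective :
    ∀ ⦃S C : SchemeOver ℂ⦄ (hS : IsSmoothProjective 2 S) (hC : IsSmoothProjective 1 C) (i : C ⟶ S),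
      Function.Injective (complexBetti.map i 1) →
        ∃ (A : HodgeModel 2 S) (B : HodgeModel 1 C) (φ : complexBetti C 1 →ₗ[ℂ] complexBetti S 1),
          (∀ c, IsRationalClass c → IsRationalClass (φ c)) ∧
          (∀ (p q : ℕ), p + q = 1 → ∀ c, B.pullback 1 c ∈ B.hodgePQ 1 p q →
            A.pullback 1 (φ c) ∈ A.hodgePQ 1 p q) ∧
          Function.Surjective φ := by
  intro S C hS hC i hi
  classical
  -- 1. real (Hodge symmetric) models and the weight-one Hodge structures on `H¹(–(ℂ); ℚ)`
  obtain ⟨A, hAreal⟩ := exists_isReal_hodgeModel_holds 2 S hS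
  obtain ⟨B, hBreal⟩ := exists_isReal_hodgeModel_holds 1 C hC
  have hA : A.IsHodgeSymmetric := hAreal.isHodgeSymmetric
  have hB : B.IsHodgeSymmetric := hBreal.isHodgeSymmetric
  -- 2. `i^*` on rational cohomology, a morphism of Hodge structures
  set f := A.hodgeStructureHom hS hodgePQ_independent_of_hodgeModel_holds hA B hC hB i 1 with hf
  set βS := ofRatClassBaseChangeEquiv hS 1 with hβS
  set βC := ofRatClassBaseChangeEquiv hC 1 with hβC
  -- its complexification is `i^*` on `H¹(–(ℂ); ℂ)` under `β`
  have hnat : ∀ x, βC (f.toLinearMap.baseChange ℂ x) = complexBetti.map i 1 (βS x) := fun x ↦ by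
    rw [hβC, hβS, ofRatClassBaseChangeEquiv_apply, ofRatClassBaseChangeEquiv_apply, hf,
      HodgeModel.hodgeStructureHom_toLinearMap]
    exact HodgeModel.ofRatClassBaseChange_baseChange_map i 1 x
  -- 3. `i^*` is injective on `H¹(S(ℂ); ℚ)`
  have hfCinj : Function.Injective (f.toLinearMap.baseChange ℂ) := by
    intro x y hxy
    have h := congrArg βC hxy
    rw [hnat, hnat] at h
    exact βS.injective (hi h)
  have hfinj : Function.Injective f.toLinearMap := by
    intro v w hvw
    apply HodgeStructure.ofRat_injective
    apply hfCinj
    rw [HodgeStructure.baseChange_ofRat, HodgeStructure.baseChange_ofRat, hvw]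
  -- 4. finite-dimensionality and polarisability of `H¹(C(ℂ); ℚ)`; the retraction `r`
  letI := hC.chartedSpace
  haveI := ComplexPoints.compactSpace_of_isSmoothProjective hC
  haveI := ComplexPoints.t2Space_of_isSmoothProjective hC
  haveI : Module.Finite ℚ (bettiCohomology C 1) :=
    finite_singularCohomology_of_compact_chartedSpace ℚ ℚ (d := 2 * 1) 1
  obtain ⟨r, hr⟩ := hodgeStructureHom_exists_retraction_of_injective
    (smoothProjective_hodgeStructure_isPolarizable_holds hC B hB 1) f hfinj
  have hrfC : ∀ x, r.toLinearMap.baseChange ℂ (f.toLinearMap.baseChange ℂ x) = x := fun x ↦ by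
    rw [← LinearMap.comp_apply, ← LinearMap.baseChange_comp, hr, LinearMap.baseChange_id,
      LinearMap.id_apply]
  -- 5. the map `φ = β_S ∘ (r ⊗ ℂ) ∘ β_C⁻¹`
  set φ : complexBetti C 1 →ₗ[ℂ] complexBetti S 1 :=
    βS.toLinearMap ∘ₗ (r.toLinearMap.baseChange ℂ) ∘ₗ βC.symm.toLinearMap with hφ
  have hφapply : ∀ c, φ c = βS (r.toLinearMap.baseChange ℂ (βC.symm c)) := fun c ↦ rfl
  refine ⟨A, B, φ, ?_, ?_, ?_⟩
  · -- rational classes go to rational classes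
    intro c hc
    obtain ⟨v, rfl⟩ := (isRationalClass_iff_mem_range_ofRatClass c).1 hc
    rw [hφapply, hβC, ofRatClassBaseChangeEquiv_symm_ofRatClass, HodgeStructure.baseChange_ofRat,
      hβS, ofRatClassBaseChangeEquiv_apply, ofRatClassBaseChange_ofRat]
    exact (isRationalClass_iff_mem_range_ofRatClass _).2 ⟨_, rfl⟩
  · -- type `(p, q)` goes to type `(p, q)`
    intro p q hpq c hc
    have hx : βC.symm c ∈ (B.hodgeStructure hC hB 1).piece p q := by
      rw [B.piece_eq_ratPiece hC hB hpq, HodgeModel.mem_ratPiece_iff,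
        HodgeModel.complexification_apply]
      have : ofRatClassBaseChange (ComplexPoints C) 1 (βC.symm c) = c := by
        rw [← ofRatClassBaseChangeEquiv_apply hC 1, hβC, LinearEquiv.apply_symm_apply]
      rw [this]
      exact hc
    have hrx : r.toLinearMap.baseChange ℂ (βC.symm c) ∈ (A.hodgeStructure hS hA 1).piece p q :=
      r.map_piece_le p q ⟨_, hx, rfl⟩
    rw [A.piece_eq_ratPiece hS hA hpq, HodgeModel.mem_ratPiece_iff,
      HodgeModel.complexification_apply] at hrx
    rw [hφapply, hβS, ofRatClassBaseChangeEquiv_apply]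
    exact hrx
  · -- `φ ∘ i^* = id`, so `φ` is onto
    intro x
    refine ⟨complexBetti.map i 1 x, ?_⟩
    obtain ⟨t, rfl⟩ := βS.surjective x
    rw [← hnat, hφapply, LinearEquiv.symm_apply_apply, hrfC]

end Summit.HodgeConjecture.HodgeConjecture.Theorems

end
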